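import Summits.Langlands.Langlands.Theses.AnchoredFamilySplit

/-!
# Glue of the PD-carving split of `AutomorphyLifting` (route AnchoredFamilySplit)

Closes the glue item of the split `AutomorphyLifting ⟸ PDLifting ∧ CrystallineNonPDLifting ∧ MonodromyAboveEllLifting`
(`AutomorphyLifting_of_pdsplit : PDLifting → CrystallineNonPDLifting → MonodromyAboveEllLifting → AutomorphyLifting`), filed by
`ledger route edit route-Langlands-AnchoredFamilySplit --split AutomorphyLifting --into children.json --glue-decl-name AutomorphyLifting_of_pdsplit`.
Pure logic — two excluded middles on the inlined dials of the three lifting cells («ρ potentially diagonalizable at every v ∣ ℓ»,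
else «N = 0 on D_pst at every v ∣ ℓ», else the monodromic cell).  This is the lens-6 g7 node proof `PDCarving.liftw_of_cells`
(decomp-langlands, 2026-08-30; certified as `AutomorphyLifting_of_pdsplit_proof` in the node's kit check
`nodes/lens-6-g7-PDCarving.kit_check_split.lean`), transported verbatim to the tree's declarations.  No definitions, no new mathematics.
-/

set_option linter.dupNamespace false -- project-wide option; `Summit.Langlands.Langlands` is the mandated namespace

namespace Summit.Langlands.Langlands.Theorems

open Summit.Langlands.Langlands.Theses.AnchoredFamilySplit in
/-- The glue item of the PD-carving split of `AutomorphyLifting` on route AnchoredFamilySplit: the three children imply the parent (case split on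
the two inlined p-adic Hodge dials). -/
theorem AutomorphyLifting_of_pdsplit_proof :
    Summit.Langlands.Langlands.Theses.AnchoredFamilySplit.AutomorphyLifting_of_pdsplit := by
  intro hPD hCN hM K _ _ n hcpt hn ℓ _ ι ρ hirr hgeo hlink
  refine (Classical.em _).elim (fun h₁ => hPD K n hcpt hn ℓ ι ρ h₁ hirr hgeo hlink) (fun h₁ => ?_)
  exact (Classical.em _).elim (fun h₂ => hCN K n hcpt hn ℓ ι ρ h₁ h₂ hirr hgeo hlink)
    (fun h₂ => hM K n hcpt hn ℓ ι ρ h₂ hirr hgeo hlink)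

end Summit.Langlands.Langlands.Theorems
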